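import Summits.QuantumFields.BalabanUV.Beta.SymRootedT2JetReflection
import Summits.QuantumFields.BalabanUV.Beta.SymRootedJetDictionary
import Summits.QuantumFields.BalabanUV.Beta.SymRootedMixedJetReflectionLaw
import Summits.QuantumFields.BalabanUV.Beta.SymAveragingWardRooted
import Summits.QuantumFields.BalabanUV.Beta.RootedT2JetDictionary

/-!
# `BalabanUV.Beta.SymRootedT2JetDictionary` — THE (0.4)-SYMMETRISED ROOTED JET OF A SCALAR FLUCTUATION AND OF THE REFLECTED BACKGROUND, BY ORDERS
# (β sub-cell, row D1, TABLES-SYM-LEAN S2c∕S2d, INTERFACE-LEVEL twin of an3's `RootedT2JetDictionary`; an1 gen 43; the border path to (T2-B))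

HONEST FRAMING (cell charter, verbatim): «discharging BetaPertH makes Bałaban's UV stability UNCONDITIONAL — a real
constructive-QFT result; it is NOT the continuum limit and NOT the Clay problem.»  HONEST DEPENDENCY (verbatim): «continuum YM on
T⁴ ⇐ BetaPertH ∧ nine spine estimates (0/9 proved); BetaPertH ⇐ (D1) ∧ (D4) ∧ CAP+tail; G-an2-4 gates asym, D1 and NE2/3/4.»
ABSOLUTE RULE (R-g25-7 ∕ R-D1-g30-1 (A)): the (0.4)-symmetrised averaging is the exp of the MEAN OF LOGS over the pair family
`{loop^{σ,σ′}}` with weight `((d!)²·L^d)⁻¹`; every object below is the comb module's algebra read on an1's `symPhiGAt` (S2b part 1)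
instead of `PhiGAt` — STATEMENT FOR STATEMENT under the dictionary `PhiXAt ↦ symPhiXAt`, `XjetAt ↦ symXjetAt`, `MσXAt ↦ symMσXAt`,
`L^{-d}·linAvgAt ↦ (d!·L^d)⁻¹·symLinU`, `L^{-d}·hessUAt ↦ ((d!)²L^d)⁻¹·symHessUAt`, `L^{-2d}·vhUAt ↦ ((d!)²L^{2d})⁻¹·symVhUAt`
(an3-g63 [AN3-G63-S2C] (C-ii): constants PER BCH ORDER; CONVENTION `(d!)²` un-normalised inside order-2 sym functionals).
FAMILY-INDEPENDENT chart ∕ letter ∕ `Tau`-algebra lemmas of the comb module are imported BY NAME, never re-proved.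
DERIVED cell leaf: [folklore] ring algebra; the `sym*` families are [our object]s.  No statement of Bałaban's papers is typed here, no
`[cite:]` tag, no `Prop` is minted, no binder of the β-function wall (`hW`/`hR`/`D1Tel`/`D1Rep`, (D1), `BetaPertH`) is instantiated or
discharged; nothing about the VALUES of `symMixFFAt`∕`symVh₂SAt` and no (T2-B)∕(T2-M₂) letter is discharged in this file.
NOT D1, NOT BetaPertH, NOT continuum, NOT Clay.  NOT summit progress.
Provenance: β sub-cell, TABLES-SYM-LEAN S2c option (C) (S2C-SCOPE-v1 94facb80ac685517), unit b2b-balaban-beta-an1-g43 (W-supplier AN1,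
FREEZE (0): scratch for a courier; an1 files nothing), 2026-08-21; no existing file touched.

## What this module proves (sym twin of `RootedT2JetDictionary` §2 (jet flips), §4, §5; its §1 letters, §2 `flip2` algebra and §3 projections
## are letter ∕ `Tau` algebra, the comb module's BY NAME; §3's one-parameter computation is an1's `SymRootedJetDictionary` §3–§4)
Write `Z = symLinU ρ`, `ℓ_! = d!·L^d`, `ℓ²_! = (d!)²·L^{2d}`.
* §2 `symQjetAt_upF_neg_B` ∕ `_neg_B'` (`B ↦ −B` is the `τ₁`-flip, `B′ ↦ −B′` the `τ₂`-flip of the symmetrised rooted jet) and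
  `symT2At_upF_neg_B` ∕ `_neg_B'` (the symmetrised second-order response is odd in each background).
* §4 `c00_symQjetAt_upF = ℓ_!⁻¹ • Z_W`, `c10_symQjetAt_upF = (2ℓ²_!)⁻¹ • symVhUAt ρ W B`, `c01_symQjetAt_upF = (2ℓ²_!)⁻¹ • symVhUAt ρ W B′`.
* §5 `symNR_eq`, `symNR_eq_symPhiGAt_Y_add`, `c10_symNR = ℓ_!⁻¹ • Z_b`, `c01_symNR = ℓ_!⁻¹ • Z_c`,
  `c11_symNR = (2(d!)²L^d)⁻¹ • (symHessUAt ρ b c + d!·Z[b,c]) + ℓ_!⁻¹ • Z(dR) + (2ℓ²_!)⁻¹ • {Z_b, Z_c}`.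
Every statement carries the extra hypothesis `(hd : ((d ! : ℕ) : 𝕜) ≠ 0)` of the sym dictionary (threaded before `hL`).
-/

namespace Summit.QuantumFields.BalabanUV.Beta.SymRootedT2JetDictionary

open Finset
open scoped Nat
open Literature.MathematicalPhysics.QuantumFieldTheory.Balaban1983to89
open Literature.MathematicalPhysics.QuantumFieldTheory.Balaban1983to89.Beta
open Literature.MathematicalPhysics.QuantumFieldTheory.Balaban1983to89.Beta.AffineAveraging
open Literature.MathematicalPhysics.QuantumFieldTheory.Balaban1983to89.Beta.AveragingContours
open Literature.MathematicalPhysics.QuantumFieldTheory.Balaban1983to89.Beta.AveragingContoursRooted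
open Literature.MathematicalPhysics.QuantumFieldTheory.Balaban1983to89.Beta.TransportedContourVariables
open Literature.MathematicalPhysics.QuantumFieldTheory.Balaban1983to89.Beta.AveragingHessianKernels
open Literature.MathematicalPhysics.QuantumFieldTheory.Balaban1983to89.Beta.AveragingHessianKernelsRooted
open Literature.MathematicalPhysics.QuantumFieldTheory.Balaban1983to89.Beta.AveragingThirdJet
open Literature.MathematicalPhysics.QuantumFieldTheory.Balaban1983to89.Beta.AveragingThirdJet.Tau
open Literature.MathematicalPhysics.QuantumFieldTheory.Balaban1983to89.Beta.AveragingMixedJetTables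
open ResolventReflection (sref bref)
open Summit.QuantumFields.BalabanUV.Beta.RootedHolonomyReflection (R1g)
open Summit.QuantumFields.BalabanUV.Beta.RootedHolonomyReflectionHol (reflPair)
open Summit.QuantumFields.BalabanUV.Beta.RootedJetReflection (GfL GbL fst_GfL fst_GbL)
open Summit.QuantumFields.BalabanUV.Beta.SymRootedJetReflection (symPhiLAt symQjetLAt symQjetAt_eq_symQjetLAt)
open Summit.QuantumFields.BalabanUV.Beta.SymAveragingMixedJetTables (symPhiGAt symPhiRAt symQjetAt symT2At map_symPhiGAt symPhiGAt_one symT2At_symm)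
open Summit.QuantumFields.BalabanUV.Beta.SymAveragingHessianCounts (loopPAt symLinU symHessUAt symVhUAt symHessUAt_symm)
open Summit.QuantumFields.BalabanUV.Beta.SymAveragingWardRooted (symZ_sub symZ_eq_symLinU)
open Summit.QuantumFields.BalabanUV.Beta.RootedJetReflectionExpanded (ι_neg dR reflPair_Ebg_Ebi reflPair_Ebi_Ebg ad1R ad12R)
open Summit.QuantumFields.BalabanUV.Beta.RootedJetTwist (lineHom flip1 flip1_ι)
open Summit.QuantumFields.BalabanUV.Beta.SymRootedJetTwist (map_symQjetLAt)
open Summit.QuantumFields.BalabanUV.Beta.SymRootedJetDictionary (inv_smul_sum_box_loopPAt symPhiGAt_X1 snd_symPhiGAt_X1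
  c11_logT_symPhiGAt_Y c00_symPhiGAt symPhiGAt_add_top symLinU_bw_swap c10_symPhiGAt_Y c01_symPhiGAt_Y symPhiGAt_Y_zero
  c11_logT_symPhiGAt_Y_norm)
open Summit.QuantumFields.BalabanUV.Beta.RootedMixedJetReflectionLaw (D1R)
open Summit.QuantumFields.BalabanUV.Beta.SymRootedT2JetReflection (symNR)
open Summit.QuantumFields.BalabanUV.Beta.RootedT2JetDictionary (R1g_upF shadow_upF ad1R_upF A12R ad12R_upF flip2 c00_flip2 c10_flip2 c01_flip2
  c11_flip2 flip2_ι flip1_Ebg flip1_Ebi flip2_Ebg flip2_Ebi pr1 pr2 fst_pr1 snd_pr1 fst_pr2 snd_pr2 c11_eq_logT_add reflPair_Ebg_Ebi_eq_Yf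
  reflPair_Ebi_Ebg_eq_Yb)

variable {𝕜 : Type*} [Field 𝕜] {d : ℕ} {𝔸 : Type*} [Ring 𝔸] [Algebra 𝕜 𝔸]

/-! ## §1 The letters of 33I at a scalar fluctuation: family-independent, the comb module's `R1g_upF shadow_upF ad1R_upF A12R ad12R_upF` BY NAME -/

/-! ## §2 Background sign flips (the `flip2` algebra and the letter flips are the comb module's BY NAME) -/

/-- [folklore] **`B ↦ −B` IS THE `τ₁`-FLIP** on the symmetrised rooted jet of a scalar fluctuation. -/
theorem symQjetAt_upF_neg_B (ρ : Fin d → ℤ) (W B B' : Form1 d 𝔸) (L : ℕ) (μ : Fin d) (y : Fin d → ℤ) :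
    symQjetAt 𝕜 ρ (upF W) (-B) B' L μ y = flip1 (𝕜 := 𝕜) (symQjetAt 𝕜 ρ (upF W) B B' L μ y) := by
  rw [symQjetAt_eq_symQjetLAt, symQjetAt_eq_symQjetLAt, map_symQjetLAt]
  simp only [upF, flip1_ι, flip1_Ebg, flip1_Ebi]; rfl

/-- [folklore] **`B′ ↦ −B′` IS THE `τ₂`-FLIP** on the symmetrised rooted jet of a scalar fluctuation. -/
theorem symQjetAt_upF_neg_B' (ρ : Fin d → ℤ) (W B B' : Form1 d 𝔸) (L : ℕ) (μ : Fin d) (y : Fin d → ℤ) :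
    symQjetAt 𝕜 ρ (upF W) B (-B') L μ y = flip2 (𝕜 := 𝕜) (symQjetAt 𝕜 ρ (upF W) B B' L μ y) := by
  rw [symQjetAt_eq_symQjetLAt, symQjetAt_eq_symQjetLAt, map_symQjetLAt]
  simp only [upF, flip2_ι, flip2_Ebg, flip2_Ebi]; rfl

variable (𝕜) in
/-- [folklore] **THE SECOND-ORDER RESPONSE IS ODD IN EACH BACKGROUND**: `symT2At ρ (upF W) (−B) B′ = −symT2At ρ (upF W) B B′`. -/
theorem symT2At_upF_neg_B (ρ : Fin d → ℤ) (W B B' : Form1 d 𝔸) (L : ℕ) (μ : Fin d) (y : Fin d → ℤ) :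
    symT2At 𝕜 ρ (upF W) (-B) B' L μ y = -symT2At 𝕜 ρ (upF W) B B' L μ y := by
  simp only [symT2At, symQjetAt_upF_neg_B, symQjetAt_upF_neg_B', RootedJetTwist.c11_flip1, c11_flip2, neg_add]

variable (𝕜) in
/-- [folklore] … and `symT2At ρ (upF W) B (−B′) = −symT2At ρ (upF W) B B′`. -/
theorem symT2At_upF_neg_B' (ρ : Fin d → ℤ) (W B B' : Form1 d 𝔸) (L : ℕ) (μ : Fin d) (y : Fin d → ℤ) :
    symT2At 𝕜 ρ (upF W) B (-B') L μ y = -symT2At 𝕜 ρ (upF W) B B' L μ y := by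
  rw [symT2At_symm, symT2At_upF_neg_B, symT2At_symm]

/-! ## §3 The normalised one-parameter computation: `pr1 pr2 c11_eq_logT_add` are the comb module's BY NAME; `c10_symPhiGAt_Y c01_symPhiGAt_Y
symPhiGAt_Y_zero c11_logT_symPhiGAt_Y_norm` are an1's `SymRootedJetDictionary` §3–§4 (opened above) -/

/-! ## §4 Orders `B⁰`, `B¹` of the rooted jet of a scalar fluctuation -/

section Orders

variable (hd : ((d ! : ℕ) : 𝕜) ≠ 0) {L : ℕ} (hL : (L : 𝕜) ≠ 0) (h2 : (2 : 𝕜) ≠ 0)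
include hd hL

/-- [folklore] **ORDER `B⁰` (rooted `c00_Qjet`)**: `c00 symQ^ρ(upF W; B, B′) = (d!·L^d)⁻¹ • symLinU ρ W`. -/
theorem c00_symQjetAt_upF (ρ : Fin d → ℤ) (W B B' : Form1 d 𝔸) (μ : Fin d) (y : Fin d → ℤ) :
    c00 (symQjetAt 𝕜 ρ (upF W) B B' L μ y) = ((d ! : 𝕜) * (L : 𝕜) ^ d)⁻¹ • symLinU ρ W L μ y := by
  have hG : ∀ κ x, mapDual (Tau.aug (𝕜 := 𝕜)) (Gf (upF W) B B' κ x) = X1 W κ x :=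
    fun κ x => TrivSqZeroExt.ext (by simp [X1]) (by simp [X1])
  have hGb : ∀ κ x, mapDual (Tau.aug (𝕜 := 𝕜)) (Gb (upF W) B B' κ x) = X1b W κ x :=
    fun κ x => TrivSqZeroExt.ext (by simp [X1b]) (by simp [X1b])
  have hG0 : ∀ κ x, mapDual (Tau.aug (𝕜 := 𝕜)) (Gf 0 B B' κ x) = 1 := fun κ x => TrivSqZeroExt.ext (by simp) (by simp)
  have hGb0 : ∀ κ x, mapDual (Tau.aug (𝕜 := 𝕜)) (Gb 0 B B' κ x) = 1 := fun κ x => TrivSqZeroExt.ext (by simp) (by simp)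
  unfold symQjetAt symPhiRAt
  have key := congrArg TrivSqZeroExt.snd (map_logT (R := Rho 𝔸) (R' := DualNumber 𝔸) (mapDual (Tau.aug (𝕜 := 𝕜)))
    (symPhiGAt 𝕜 ρ (Gf (upF W) B B') (Gb (upF W) B B') L μ y * invT (symPhiGAt 𝕜 ρ (Gf 0 B B') (Gb 0 B B') L μ y)))
  simp only [map_mul, map_invT, map_symPhiGAt, hG, hGb, hG0, hGb0, snd_mapDual, Tau.aug_apply] at key
  rw [symPhiGAt_one, invT_one, mul_one] at key
  refine key.trans ?_
  have hX : symPhiGAt 𝕜 ρ (fun κ x => X1 W κ x) (fun κ x => X1b W κ x) L μ y = symPhiGAt 𝕜 ρ (X1 W) (X1b W) L μ y := rfl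
  rw [hX, symPhiGAt_X1, logT_dmk_one, snd_dmk, inv_smul_sum_box_loopPAt ρ W hd hL, add_sub_cancel]

include h2

/-- [folklore] **ORDER `B¹`, `B`-SLOT (rooted `c10_Qjet`)**: `c10 symQ^ρ(upF W; B, B′) = (2(d!)²L^{2d})⁻¹ • symVhUAt ρ W B`. -/
theorem c10_symQjetAt_upF (ρ : Fin d → ℤ) (W B B' : Form1 d 𝔸) (μ : Fin d) (y : Fin d → ℤ) :
    c10 (symQjetAt 𝕜 ρ (upF W) B B' L μ y) = ((2 : 𝕜) * ((d ! : 𝕜) ^ 2 * (L : 𝕜) ^ (2 * d)))⁻¹ • symVhUAt ρ W B L μ y := by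
  have hG : ∀ κ x, piB (𝕜 := 𝕜) (Gf (upF W) B B' κ x) = Yf W B κ x :=
    fun κ x => ext4 (by simp [Yf]) (by simp [Yf]) (by simp [Yf]) (by simp [Yf])
  have hGb : ∀ κ x, piB (𝕜 := 𝕜) (Gb (upF W) B B' κ x) = Yb W B κ x :=
    fun κ x => ext4 (by simp [Yb]) (by simp [Yb]) (by simp [Yb]) (by simp [Yb])
  have hG0 : ∀ κ x, piB (𝕜 := 𝕜) (Gf 0 B B' κ x) = Yf 0 B κ x :=
    fun κ x => ext4 (by simp [Yf]) (by simp [Yf]) (by simp [Yf]) (by simp [Yf])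
  have hGb0 : ∀ κ x, piB (𝕜 := 𝕜) (Gb 0 B B' κ x) = Yb 0 B κ x :=
    fun κ x => ext4 (by simp [Yb]) (by simp [Yb]) (by simp [Yb]) (by simp [Yb])
  unfold symQjetAt symPhiRAt
  have key := congrArg c11 (map_logT (R := Rho 𝔸) (R' := Tau 𝔸) (piB (𝕜 := 𝕜))
    (symPhiGAt 𝕜 ρ (Gf (upF W) B B') (Gb (upF W) B B') L μ y * invT (symPhiGAt 𝕜 ρ (Gf 0 B B') (Gb 0 B B') L μ y)))
  simp only [map_mul, map_invT, map_symPhiGAt, hG, hGb, hG0, hGb0] at key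
  rw [piB_apply, c11_mk] at key
  refine key.trans ?_
  exact c11_logT_symPhiGAt_Y_norm hd hL h2 ρ W B μ y

/-- [folklore] **ORDER `B¹`, `B′`-SLOT (rooted `c01_Qjet`)**: `c01 symQ^ρ(upF W; B, B′) = (2(d!)²L^{2d})⁻¹ • symVhUAt ρ W B′`. -/
theorem c01_symQjetAt_upF (ρ : Fin d → ℤ) (W B B' : Form1 d 𝔸) (μ : Fin d) (y : Fin d → ℤ) :
    c01 (symQjetAt 𝕜 ρ (upF W) B B' L μ y) = ((2 : 𝕜) * ((d ! : 𝕜) ^ 2 * (L : 𝕜) ^ (2 * d)))⁻¹ • symVhUAt ρ W B' L μ y := by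
  have hG : ∀ κ x, piB' (𝕜 := 𝕜) (Gf (upF W) B B' κ x) = Yf W B' κ x :=
    fun κ x => ext4 (by simp [Yf]) (by simp [Yf]) (by simp [Yf]) (by simp [Yf])
  have hGb : ∀ κ x, piB' (𝕜 := 𝕜) (Gb (upF W) B B' κ x) = Yb W B' κ x :=
    fun κ x => ext4 (by simp [Yb]) (by simp [Yb]) (by simp [Yb]) (by simp [Yb])
  have hG0 : ∀ κ x, piB' (𝕜 := 𝕜) (Gf 0 B B' κ x) = Yf 0 B' κ x :=
    fun κ x => ext4 (by simp [Yf]) (by simp [Yf]) (by simp [Yf]) (by simp [Yf])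
  have hGb0 : ∀ κ x, piB' (𝕜 := 𝕜) (Gb 0 B B' κ x) = Yb 0 B' κ x :=
    fun κ x => ext4 (by simp [Yb]) (by simp [Yb]) (by simp [Yb]) (by simp [Yb])
  unfold symQjetAt symPhiRAt
  have key := congrArg c11 (map_logT (R := Rho 𝔸) (R' := Tau 𝔸) (piB' (𝕜 := 𝕜))
    (symPhiGAt 𝕜 ρ (Gf (upF W) B B') (Gb (upF W) B B') L μ y * invT (symPhiGAt 𝕜 ρ (Gf 0 B B') (Gb 0 B B') L μ y)))
  simp only [map_mul, map_invT, map_symPhiGAt, hG, hGb, hG0, hGb0] at key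
  rw [piB'_apply, c11_mk] at key
  refine key.trans ?_
  exact c11_logT_symPhiGAt_Y_norm hd hL h2 ρ W B' μ y

end Orders

/-! ## §5 The background `symNR` of the reflected fluctuation-free averaging -/

/-- [folklore] `symNR = symΦ^ρ(E♯, Ē♯)`: the group part of the lifted averaging at `ω = 0` is the averaging of the backgrounds
(33D `fst_GfL`). -/
theorem symNR_eq (ρ : Fin d → ℤ) (α : Fin d) (B B' : Form1 d 𝔸) (L : ℕ) (μ : Fin d) (y : Fin d → ℤ) :
    symNR 𝕜 ρ α B B' L μ y
      = symPhiGAt 𝕜 ρ (reflPair α (Ebg B B') (Ebi B B')) (reflPair α (Ebi B B') (Ebg B B')) L μ y := by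
  unfold symNR symPhiLAt
  have key := map_symPhiGAt (TrivSqZeroExt.fstHom 𝕜 (Tau 𝔸) (Tau 𝔸)) ρ (GfL 0 (reflPair α (Ebg B B') (Ebi B B')))
    (GbL 0 (reflPair α (Ebi B B') (Ebg B B'))) L μ y
  simp only [TrivSqZeroExt.fstHom_apply, fst_GfL, fst_GbL] at key
  exact key

/-- [folklore] `symNR = symΦ^ρ(Y(c;b)) + τ₁τ₂ (t(c^ρ) + ℓ⁻¹ Σ_x t(loop^ρ_x))`, `t = [b, c] + dR` (33M3a `symPhiGAt_add_top`). -/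
theorem symNR_eq_symPhiGAt_Y_add (ρ : Fin d → ℤ) (α : Fin d) (B B' : Form1 d 𝔸) (L : ℕ) (μ : Fin d) (y : Fin d → ℤ) :
    symNR 𝕜 ρ α B B' L μ y
      = symPhiGAt 𝕜 ρ (Yf (R1g α B') (R1g α B)) (Yb (R1g α B') (R1g α B)) L μ y
        + mk 0 0 0 ((segUp (bw (R1g α B) (R1g α B') + dR α B B') ((L : ℤ) • y + ρ) μ L).sum
          + ((d ! : 𝕜) ^ 2 * (L : 𝕜) ^ d)⁻¹ • ∑ b ∈ box d L, ∑ σ : Equiv.Perm (Fin d), ∑ σ' : Equiv.Perm (Fin d),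
              (loopPAt σ σ' ρ (bw (R1g α B) (R1g α B') + dR α B B') L μ y b).sum) := by
  rw [symNR_eq, reflPair_Ebg_Ebi_eq_Yf, reflPair_Ebi_Ebg_eq_Yb]
  exact symPhiGAt_add_top (fun κ x => by simp [Yf]) (fun κ x => by simp [Yb]) _ ρ L μ y

section symNRComponents

variable (hd : ((d ! : ℕ) : 𝕜) ≠ 0) {L : ℕ} (hL : (L : 𝕜) ≠ 0) (h2 : (2 : 𝕜) ≠ 0)
include hd hL

/-- [folklore] `c10 symNR = (d!·L^d)⁻¹ • Z_b`. -/
theorem c10_symNR (ρ : Fin d → ℤ) (α : Fin d) (B B' : Form1 d 𝔸) (μ : Fin d) (y : Fin d → ℤ) :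
    c10 (symNR 𝕜 ρ α B B' L μ y) = ((d ! : 𝕜) * (L : 𝕜) ^ d)⁻¹ • symLinU ρ (R1g α B) L μ y := by
  rw [symNR_eq_symPhiGAt_Y_add, c10_add, c10_mk, add_zero, c10_symPhiGAt_Y hd hL]

/-- [folklore] `c01 symNR = (d!·L^d)⁻¹ • Z_c`. -/
theorem c01_symNR (ρ : Fin d → ℤ) (α : Fin d) (B B' : Form1 d 𝔸) (μ : Fin d) (y : Fin d → ℤ) :
    c01 (symNR 𝕜 ρ α B B' L μ y) = ((d ! : 𝕜) * (L : 𝕜) ^ d)⁻¹ • symLinU ρ (R1g α B') L μ y := by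
  rw [symNR_eq_symPhiGAt_Y_add, c01_add, c01_mk, add_zero, c01_symPhiGAt_Y hd hL]

include h2 in
/-- [folklore] **`c11 symNR = (2(d!)²L^d)⁻¹ • (symHessUAt ρ b c + d!·Z[b,c]) + (d!·L^d)⁻¹ • Z(dR) + (2(d!)²L^{2d})⁻¹ • {Z_b, Z_c}`** (33M3a `c11_logT_symPhiGAt_Y`,
`symHessUAt_symm`, `symLinU_bw_swap`). -/
theorem c11_symNR (ρ : Fin d → ℤ) (α : Fin d) (B B' : Form1 d 𝔸) (μ : Fin d) (y : Fin d → ℤ) :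
    c11 (symNR 𝕜 ρ α B B' L μ y)
      = ((2 : 𝕜) * ((d ! : 𝕜) ^ 2 * (L : 𝕜) ^ d))⁻¹ • (symHessUAt ρ (R1g α B) (R1g α B') L μ y + (d ! : ℤ) • symLinU ρ (bw (R1g α B) (R1g α B')) L μ y)
        + ((d ! : 𝕜) * (L : 𝕜) ^ d)⁻¹ • symLinU ρ (dR α B B') L μ y
        + ((2 : 𝕜) * ((d ! : 𝕜) ^ 2 * (L : 𝕜) ^ (2 * d)))⁻¹ • (symLinU ρ (R1g α B) L μ y * symLinU ρ (R1g α B') L μ y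
            + symLinU ρ (R1g α B') L μ y * symLinU ρ (R1g α B) L μ y) := by
  have hℓ : ((L : 𝕜) ^ d) ≠ 0 := pow_ne_zero d hL
  have h00 : c00 (symPhiGAt 𝕜 ρ (Yf (R1g α B') (R1g α B)) (Yb (R1g α B') (R1g α B)) L μ y) = 1 :=
    c00_symPhiGAt (fun κ x => by simp [Yf]) (fun κ x => by simp [Yb]) ρ L μ y
  have hZ : symLinU ρ (bw (R1g α B) (R1g α B') + dR α B B') L μ y
      = symLinU ρ (bw (R1g α B) (R1g α B')) L μ y + symLinU ρ (dR α B B') L μ y := by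
    have h := symZ_sub ρ (bw (R1g α B) (R1g α B') + dR α B B') (dR α B B') L μ y
    rw [symZ_eq_symLinU, symZ_eq_symLinU, symZ_eq_symLinU, add_sub_cancel_right] at h
    exact eq_add_of_sub_eq h.symm
  rw [symNR_eq_symPhiGAt_Y_add, c11_add, c11_mk, inv_smul_sum_box_loopPAt ρ _ hd hL, add_sub_cancel, c11_eq_logT_add (𝕜 := 𝕜) _ h00,
    c11_logT_symPhiGAt_Y ρ _ _ hd hL h2, c10_symPhiGAt_Y hd hL, c01_symPhiGAt_Y hd hL, symHessUAt_symm ρ (R1g α B) (R1g α B'),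
    symLinU_bw_swap ρ (R1g α B) (R1g α B'), hZ]
  simp only [smul_add, smul_neg, smul_mul_assoc, mul_smul_comm, smul_smul, pow_mul', sq]
  match_scalars <;> (field_simp; try ring)

end symNRComponents

end Summit.QuantumFields.BalabanUV.Beta.SymRootedT2JetDictionary
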